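import Mathlib
import Summits.ValiantsHypothesis.ValiantsHypothesis.Theses.NewtonUnitEquations
import Summits.ValiantsHypothesis.ValiantsHypothesis.Theorems.DissociatedFixedK.Negative.LoadBearing

/-!
# Disproof work file for crux `NewtonUnitEquations.NewtonTauWeak` (stmt-ValiantsHypothesis-5904)

Standing disprover refuter-cdisprove-stmt-ValiantsHypothesis-5904-0 (gen 1, cycle 1).  Prose lives in
docstrings only; everything outside §N is `sorry`-free.  LANDED / PROPOSED in the tree (importable,
namespace `Summit.ValiantsHypothesis.ValiantsHypothesis.Theorems.NewtonTauWeak.Negative`):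
`Theorems/NewtonTauWeak/Negative/Zonogon.lean` (ACCEPTED p76934: §0, §C, `not_newtonTauBoundNoM`),
`Theorems/NewtonTauWeak/Negative/MatrixTransfer.lean` (ACCEPTED p84824: §D),
`Theorems/NewtonTauWeak/Negative/LoadBearing.lean` (p85038 pending: §0', §A, §B).  INDEX:

* §0  `vert` — the crux's literal vertex count `ncard (extremePoints ℝ (convexHull ℝ (supp ↪ ℝ²)))`,
      `vert_le_card_support` (so `vert ≤ k t^m`; no junk values).
* §C  ZONOGON `zProd m = Π_{j<m}(1 + X Y^j)`: expansion with COUNT coefficients (no subset-sum uniqueness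
      needed), the zonotope vertex criterion `sum_lt_sum_filter_pos`, both chains are vertices,
      `two_mul_le_vert_zProd : 2m ≤ vert (zProd m)` — KPTT's no-cancellation bound `m·t` for ONE product
      (arXiv:1308.2286 p4) is ATTAINED at `t = 2`; hence `not_newtonTauBoundNoM`: the `a = 0` form
      `vert ≤ (kt+2)^b` is FALSE, the `m`-dependence (`2^{am}`) is indispensable.
* §0' probe — the crux elaborates and is literally the weak KPTT bound on `vert` (`newtonTauWeak_iff`);
      it is KPTT's Conjecture 1 in the WEAK form of their Theorem 1 (p4: "for instance
      `2^{O(m)}(kt)^{O(1)}` would be sufficient"), over `ℂ`; corners `k = 0` (`vert = 0`), `m = 0`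
      (`vert ≤ 1`) harmless; quantifier order `∃ a b ∀ k m t f` = "universal constants", as printed.
* §A  LOAD-BEARING: the only hypothesis (`t`-sparsity) cannot be dropped
      (`newtonTauWeak_false_without_sparsity`).
* §B  SHAPE OF THE BOUND: neither `k` nor `t` can be dropped either (`not_newtonTauBoundNoK`,
      `not_newtonTauBoundNoT`; chain witnesses from `DissociatedFixedK/Negative/LoadBearing.lean`).
* §E  HIERARCHY (workfile only): `NewtonTauPoly → NewtonTauWeak → TwoProducts`
      (`newtonTauWeak_of_newtonTauPoly`, `twoProducts_of_newtonTauWeak`): KPTT Conj. 1 (poly form) implies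
      the crux, and the crux implies the sibling crux 5906 (`a' = a+b`, `b' = b`) — a kill of `TwoProducts`
      kills this crux, a kill of this crux kills KPTT Conj. 1.
* §D  BLOCK TRANSFER made formal (`vert_matrixProd_le_of_newtonTauWeak`, sorry-free): under the crux an
      entry of a product of `m·B` matrices of size `w` with `t`-sparse entries has
      `vert ≤ 2^{am}(w^{m+1}·w^{B+1}t^B + 2)^b`; so products of `ℓ` signed-monomial `2×2` matrices with
      `2^{ω(√ℓ)}` Newton vertices would REFUTE the crux (kill target T2; `poly(ℓ)` is all that is known).
* §N  WHY IT RESISTS / where a kill could live (notes N1–N6): the transfer is generic over VP (N1 =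
      the Hrubeš–Yehudayoff 2021 refutation programme, re-derived here; experts BELIEVE THE CRUX FALSE —
      Chatterjee–Gajjar–Tengse 2023 p3 — but HY21 could not complete it:
      the crux predicts `sh(Newt g) ≤ 2^{O(√d log(Ns))}` for every VP family, e.g. `sh(B_n) ≤ 2^{O(√n log n)}`
      for the assignment polytope, known only `n^{Ω(log n)} ≤ sh(B_n) ≤ n·4^n`); the elementary block
      transfer for short matrix products (N2: kill target = `2×2` signed-monomial products of length `ℓ`
      with `2^{ω(√ℓ)}` vertices); the arithmetic every counterexample must satisfy (N3); attack ledger (N4);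
      experiments (N5, kit jobs: cancellation never beat the no-cancellation count); advice to provers
      (N6); the counting heuristic for generic coefficient designs (N7: digit grids give only
      `V ≲ (kmt)^{1/3}`; a killing frame needs a thin second convex layer — open additive question).
-/

set_option linter.dupNamespace false

namespace Summit.ValiantsHypothesis.ValiantsHypothesis.Cruxes.NewtonTauWeak.Disproof

open scoped BigOperators
open MvPolynomial Finset
open Summit.ValiantsHypothesis.ValiantsHypothesis.Theses.NewtonUnitEquations (NewtonTauWeak)
open Summit.ValiantsHypothesis.ValiantsHypothesis.Theorems.DissociatedFixedK.Negative
  (chainPt chainPoly chainPt_injective support_chainPoly vertices_chainPoly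
   mem_extremePoints_convexHull_of_strict_sep emb emb_injective)

noncomputable section

/-! ## §0 The crux's vertex count -/

/-- The crux's vertex count of a bivariate polynomial: number of extreme points of the convex hull of
the support embedded in `ℝ²` (literal subterm of the crux). -/
def vert (p : MvPolynomial (Fin 2) ℂ) : ℕ :=
  (Set.extremePoints ℝ (convexHull ℝ ((fun e : Fin 2 →₀ ℕ => fun i : Fin 2 => ((e i : ℕ) : ℝ)) ''
    (p.support : Set (Fin 2 →₀ ℕ))))).ncard

/-- The vertex count is at most the number of monomials (so `vert ≤ k·t^m` trivially; no junk values). -/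
theorem vert_le_card_support (p : MvPolynomial (Fin 2) ℂ) : vert p ≤ p.support.card := by
  unfold vert
  have hfin : ((fun e : Fin 2 →₀ ℕ => fun i : Fin 2 => ((e i : ℕ) : ℝ)) ''
      (p.support : Set (Fin 2 →₀ ℕ))).Finite := p.support.finite_toSet.image _
  calc (Set.extremePoints ℝ (convexHull ℝ ((fun e : Fin 2 →₀ ℕ => fun i : Fin 2 => ((e i : ℕ) : ℝ)) ''
        (p.support : Set (Fin 2 →₀ ℕ))))).ncard
      ≤ ((fun e : Fin 2 →₀ ℕ => fun i : Fin 2 => ((e i : ℕ) : ℝ)) '' (p.support : Set (Fin 2 →₀ ℕ))).ncard :=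
        Set.ncard_le_ncard extremePoints_convexHull_subset hfin
    _ ≤ (p.support : Set (Fin 2 →₀ ℕ)).ncard := Set.ncard_image_le p.support.finite_toSet
    _ = p.support.card := Set.ncard_coe_finset _

/-! ## §C Zonogon machinery: `Π_{j<m} (1 + X·Y^j)` -/

/-- General strict exposure on subsets (the zonotope vertex criterion): if no weight vanishes on `S`,
then among `T ⊆ S` the sum `Σ_{j∈T} w j` is maximised EXACTLY at the set of indices of positive weight. -/
theorem sum_lt_sum_filter_pos (S T : Finset ℕ) (w : ℕ → ℝ) (hw : ∀ j ∈ S, w j ≠ 0) (hT : T ⊆ S)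
    (hne : T ≠ S.filter (fun j => 0 < w j)) :
    ∑ j ∈ T, w j < ∑ j ∈ S.filter (fun j => 0 < w j), w j := by
  classical
  set U := S.filter (fun j => 0 < w j) with hU
  have hdecT : ∑ j ∈ T, w j = ∑ j ∈ T ∩ U, w j + ∑ j ∈ T \ U, w j :=
    (Finset.sum_inter_add_sum_sdiff T U _).symm
  have hdecU : ∑ j ∈ U, w j = ∑ j ∈ U ∩ T, w j + ∑ j ∈ U \ T, w j :=
    (Finset.sum_inter_add_sum_sdiff U T _).symm
  have hneg : ∀ j ∈ T \ U, w j < 0 := by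
    intro j hj
    rw [Finset.mem_sdiff] at hj
    have hjS : j ∈ S := hT hj.1
    have hnot : ¬ 0 < w j := fun h => hj.2 (Finset.mem_filter.mpr ⟨hjS, h⟩)
    exact lt_of_le_of_ne (not_lt.mp hnot) (hw j hjS)
  have hposU : ∀ j ∈ U \ T, 0 < w j := by
    intro j hj
    rw [Finset.mem_sdiff, Finset.mem_filter] at hj
    exact hj.1.2
  have h1 : ∑ j ∈ T \ U, w j ≤ 0 := Finset.sum_nonpos fun j hj => (hneg j hj).le
  have h2 : 0 ≤ ∑ j ∈ U \ T, w j := Finset.sum_nonneg fun j hj => (hposU j hj).le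
  have hIT : T ∩ U = U ∩ T := Finset.inter_comm _ _
  by_cases hA : (T \ U).Nonempty
  · have h1' : ∑ j ∈ T \ U, w j < 0 := Finset.sum_neg hneg hA
    rw [hdecT, hdecU, hIT]
    linarith
  · rw [Finset.not_nonempty_iff_eq_empty, Finset.sdiff_eq_empty_iff_subset] at hA
    have hB : (U \ T).Nonempty := by
      rw [Finset.nonempty_iff_ne_empty, Ne, Finset.sdiff_eq_empty_iff_subset]
      intro hUT
      exact hne (Finset.Subset.antisymm hA hUT)
    have h2' : 0 < ∑ j ∈ U \ T, w j := Finset.sum_pos hposU hB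
    have hTU : T \ U = ∅ := Finset.sdiff_eq_empty_iff_subset.mpr hA
    rw [hdecT, hdecU, hIT, hTU, Finset.sum_empty]
    linarith

/-- Exponent vector of the monomial `X Y^j`. -/
def v (j : ℕ) : Fin 2 →₀ ℕ := Finsupp.single 0 1 + Finsupp.single 1 j

/-- `X`-degree of `X Y^j`. -/
@[simp] theorem v_zero (j : ℕ) : v j 0 = 1 := by simp [v]

/-- `Y`-degree of `X Y^j`. -/
@[simp] theorem v_one (j : ℕ) : v j 1 = j := by simp [v]

/-- The binomial factor `1 + X Y^j` (2 monomials). -/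
def zFactor (j : ℕ) : MvPolynomial (Fin 2) ℂ := 1 + monomial (v j) 1

/-- Exponent of the expansion term indexed by a set `T` of factor indices: `Σ_{j∈T} v j`. -/
def expo (T : Finset ℕ) : Fin 2 →₀ ℕ := ∑ j ∈ T, v j

/-- `X`-degree of the `T`-term: `|T|`. -/
theorem expo_zero (T : Finset ℕ) : expo T 0 = T.card := by
  simp [expo, Finsupp.finsetSum_apply]

/-- `Y`-degree of the `T`-term: `Σ T`. -/
theorem expo_one (T : Finset ℕ) : expo T 1 = ∑ j ∈ T, j := by
  simp [expo, Finsupp.finsetSum_apply]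

/-- The zonogon polynomial `zProd m = Π_{j<m} (1 + X Y^j)`. -/
def zProd (m : ℕ) : MvPolynomial (Fin 2) ℂ := ∏ j ∈ range m, zFactor j

/-- Expansion: `Π_{j<m}(1 + X Y^j) = Σ_{T ⊆ range m} X^{|T|} Y^{Σ T}`. -/
theorem zProd_eq_sum (m : ℕ) : zProd m = ∑ T ∈ (range m).powerset, monomial (expo T) 1 := by
  unfold zProd zFactor
  rw [Finset.prod_one_add]
  refine Finset.sum_congr rfl fun T _ => ?_
  rw [expo, monomial_sum_one]

/-- Coefficient of `zProd m` at `e` = number of `T ⊆ range m` with `expo T = e` (a natural number: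
all coefficients are non-negative, so NO uniqueness of subset sums is needed below). -/
theorem coeff_zProd (m : ℕ) (e : Fin 2 →₀ ℕ) :
    coeff e (zProd m) = (((range m).powerset.filter fun T => expo T = e).card : ℂ) := by
  classical
  rw [zProd_eq_sum, coeff_sum]
  simp only [coeff_monomial]
  rw [Finset.sum_boole]

/-- Support of `zProd m` = exponents of the form `expo T`, `T ⊆ range m`. -/
theorem mem_support_zProd_iff (m : ℕ) (e : Fin 2 →₀ ℕ) :
    e ∈ (zProd m).support ↔ ∃ T ⊆ range m, expo T = e := by
  classical
  rw [mem_support_iff, coeff_zProd, Nat.cast_ne_zero, ← pos_iff_ne_zero, Finset.card_pos]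
  constructor
  · rintro ⟨T, hT⟩
    rw [Finset.mem_filter, Finset.mem_powerset] at hT
    exact ⟨T, hT.1, hT.2⟩
  · rintro ⟨T, hT, he⟩
    exact ⟨T, by rw [Finset.mem_filter, Finset.mem_powerset]; exact ⟨hT, he⟩⟩

/-- Sparsity of the factors: `1 + X Y^j` has at most 2 monomials. -/
theorem card_support_zFactor (j : ℕ) : (zFactor j).support.card ≤ 2 := by
  classical
  unfold zFactor
  calc (1 + monomial (v j) (1 : ℂ)).support.card
      ≤ ((1 : MvPolynomial (Fin 2) ℂ).support ∪ (monomial (v j) (1 : ℂ)).support).card :=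
        Finset.card_le_card support_add
    _ ≤ (1 : MvPolynomial (Fin 2) ℂ).support.card + (monomial (v j) (1 : ℂ)).support.card :=
        Finset.card_union_le _ _
    _ ≤ 1 + 1 := by
        gcongr
        · rw [support_one]; simp
        · exact (Finset.card_le_card support_monomial_subset).trans (by simp)

/-- The `k = 1` instance of the crux's sum-of-products with factors `1 + X Y^j` is `zProd m`. -/
theorem sum_prod_zFactor (m : ℕ) :
    (∑ _i : Fin 1, ∏ j : Fin m, zFactor (j : ℕ)) = zProd m := by
  rw [Fin.sum_univ_one (fun _ => ∏ j : Fin m, zFactor (j : ℕ))]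
  exact Fin.prod_univ_eq_prod_range zFactor m

/-- The exposing functional for the vertex `T_s = Ico s m`: `ℓ_s(x, y) = y - (s - 1/2)·x`. -/
def zExp (s : ℕ) : (Fin 2 → ℝ) →ₗ[ℝ] ℝ :=
  LinearMap.proj 1 - ((s : ℝ) - 1 / 2) • LinearMap.proj 0

/-- Evaluation of `ℓ_s`. -/
theorem zExp_apply (s : ℕ) (p : Fin 2 → ℝ) : zExp s p = p 1 - ((s : ℝ) - 1 / 2) * p 0 := by
  simp [zExp, smul_eq_mul]

/-- Weight of index `j` under `ℓ_s`: `j - s + 1/2` (positive iff `j ≥ s`, never zero). -/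
def wt (s j : ℕ) : ℝ := (j : ℝ) - s + 1 / 2

/-- `ℓ_s` of the `T`-term is the weight sum `Σ_{j∈T} (j - s + 1/2)`. -/
theorem zExp_emb_expo (s : ℕ) (T : Finset ℕ) : zExp s (emb (expo T)) = ∑ j ∈ T, wt s j := by
  rw [zExp_apply]
  simp only [emb, expo_zero, expo_one, wt]
  push_cast
  rw [Finset.sum_add_distrib, Finset.sum_sub_distrib, Finset.sum_const, Finset.sum_const, nsmul_eq_mul,
    nsmul_eq_mul]
  ring

/-- Weights are positive from `s` on. -/
theorem wt_pos {s j : ℕ} (h : s ≤ j) : 0 < wt s j := by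
  unfold wt
  have : (s : ℝ) ≤ j := by exact_mod_cast h
  linarith

/-- Weights are negative below `s`. -/
theorem wt_neg {s j : ℕ} (h : j < s) : wt s j < 0 := by
  unfold wt
  have : (j : ℝ) + 1 ≤ s := by exact_mod_cast h
  linarith

/-- No weight vanishes. -/
theorem wt_ne_zero (s j : ℕ) : wt s j ≠ 0 := by
  rcases lt_or_ge j s with hj | hj
  · exact (wt_neg hj).ne
  · exact (wt_pos hj).ne'

/-- The indices of POSITIVE `ℓ_s`-weight inside `range m` form `Ico s m`. -/
theorem filter_pos_wt (m s : ℕ) : (range m).filter (fun j => 0 < wt s j) = Ico s m := by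
  ext j
  simp only [Finset.mem_filter, Finset.mem_range, Finset.mem_Ico]
  constructor
  · rintro ⟨hjm, h⟩
    refine ⟨?_, hjm⟩
    by_contra hjs
    push Not at hjs
    exact absurd (wt_neg hjs) (not_lt.mpr h.le)
  · rintro ⟨hsj, hjm⟩
    exact ⟨hjm, wt_pos hsj⟩

/-- The indices of NEGATIVE `ℓ_s`-weight inside `range m` form `range s` (for `s ≤ m`). -/
theorem filter_neg_wt (m s : ℕ) (hs : s ≤ m) :
    (range m).filter (fun j => 0 < -wt s j) = range s := by
  ext j
  simp only [Finset.mem_filter, Finset.mem_range, neg_pos]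
  constructor
  · rintro ⟨-, h⟩
    by_contra hjs
    push Not at hjs
    exact absurd (wt_pos hjs) (not_lt.mpr h.le)
  · intro hj
    exact ⟨lt_of_lt_of_le hj hs, wt_neg hj⟩

/-- Every `Ico s m` indexes a Newton-polygon VERTEX of `zProd m` (upper chain of the zonogon, exposed
by `ℓ_s`). -/
theorem emb_expo_Ico_mem_extremePoints (m s : ℕ) :
    emb (expo (Ico s m)) ∈
      Set.extremePoints ℝ (convexHull ℝ (emb '' ((zProd m).support : Set (Fin 2 →₀ ℕ)))) := by
  classical
  apply mem_extremePoints_convexHull_of_strict_sep (l := zExp s)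
  · refine ⟨expo (Ico s m), ?_, rfl⟩
    rw [Finset.mem_coe, mem_support_zProd_iff]
    exact ⟨Ico s m, fun j hj => Finset.mem_range.mpr (Finset.mem_Ico.mp hj).2, rfl⟩
  · rintro y ⟨e, he, rfl⟩ hne
    rw [Finset.mem_coe, mem_support_zProd_iff] at he
    obtain ⟨T, hT, rfl⟩ := he
    rw [zExp_emb_expo, zExp_emb_expo, ← filter_pos_wt m s]
    apply sum_lt_sum_filter_pos (range m) T (wt s) (fun j _ => wt_ne_zero s j) hT
    rw [filter_pos_wt m s]
    rintro rfl
    exact hne rfl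

/-- Every `range s` (`s ≤ m`) indexes a Newton-polygon VERTEX of `zProd m` (lower chain of the
zonogon, exposed by `-ℓ_s`). -/
theorem emb_expo_range_mem_extremePoints (m s : ℕ) (hs : s ≤ m) :
    emb (expo (range s)) ∈
      Set.extremePoints ℝ (convexHull ℝ (emb '' ((zProd m).support : Set (Fin 2 →₀ ℕ)))) := by
  classical
  apply mem_extremePoints_convexHull_of_strict_sep (l := -zExp s)
  · refine ⟨expo (range s), ?_, rfl⟩
    rw [Finset.mem_coe, mem_support_zProd_iff]
    exact ⟨range s, Finset.range_subset_range.mpr hs, rfl⟩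
  · rintro y ⟨e, he, rfl⟩ hne
    rw [Finset.mem_coe, mem_support_zProd_iff] at he
    obtain ⟨T, hT, rfl⟩ := he
    simp only [LinearMap.neg_apply, zExp_emb_expo]
    rw [← Finset.sum_neg_distrib, ← Finset.sum_neg_distrib, ← filter_neg_wt m s hs]
    apply sum_lt_sum_filter_pos (range m) T (fun j => -wt s j)
      (fun j _ => neg_ne_zero.mpr (wt_ne_zero s j)) hT
    rw [filter_neg_wt m s hs]
    rintro rfl
    exact hne rfl

/-- `Σ_{j ∈ Ico s m} j = s (m - s) + Σ_{j < m - s} j` (shifted arithmetic series). -/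
theorem sum_Ico_id (s m : ℕ) : ∑ j ∈ Ico s m, j = s * (m - s) + ∑ j ∈ range (m - s), j := by
  rw [Finset.sum_Ico_eq_sum_range, Finset.sum_add_distrib, Finset.sum_const, Finset.card_range,
    smul_eq_mul, mul_comm]

/-- Lower bound from the upper chain alone: `zProd m` has at least `m + 1` Newton-polygon vertices. -/
theorem succ_le_vert_zProd (m : ℕ) : m + 1 ≤ vert (zProd m) := by
  classical
  unfold vert
  rw [show (fun e : Fin 2 →₀ ℕ => fun i : Fin 2 => ((e i : ℕ) : ℝ)) = emb from rfl]
  set S := emb '' ((zProd m).support : Set (Fin 2 →₀ ℕ)) with hS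
  have hfin : (Set.extremePoints ℝ (convexHull ℝ S)).Finite :=
    (((zProd m).support.finite_toSet.image emb).subset extremePoints_convexHull_subset)
  let P : Finset (Fin 2 → ℝ) := (range (m + 1)).image fun s => emb (expo (Ico s m))
  have hPcard : P.card = m + 1 := by
    rw [Finset.card_image_of_injOn, Finset.card_range]
    intro s hs s' hs' h
    have h0 := congrFun h 0
    simp only [emb, expo_zero, Nat.card_Ico, Nat.cast_inj] at h0
    have hs := Finset.mem_range.mp hs
    have hs' := Finset.mem_range.mp hs'
    omega
  have hPsub : (P : Set (Fin 2 → ℝ)) ⊆ Set.extremePoints ℝ (convexHull ℝ S) := by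
    intro p hp
    rw [Finset.mem_coe, Finset.mem_image] at hp
    obtain ⟨s, -, rfl⟩ := hp
    exact emb_expo_Ico_mem_extremePoints m s
  calc m + 1 = P.card := hPcard.symm
    _ = (P : Set (Fin 2 → ℝ)).ncard := (Set.ncard_coe_finset P).symm
    _ ≤ (Set.extremePoints ℝ (convexHull ℝ S)).ncard := Set.ncard_le_ncard hPsub hfin

/-- **Exact tightness at `k = 1`, `t = 2`: the zonogon has at least `2m` vertices** (`= m·t`, KPTT's
no-cancellation bound for one product, which by Ostrowski `Newt(fg) = Newt f + Newt g` is also an upper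
bound), namely the `m + 1` upper-chain points `Ico s m` and the `m - 1` lower-chain points `range s`,
`0 < s < m`. -/
theorem two_mul_le_vert_zProd (m : ℕ) : 2 * m ≤ vert (zProd m) := by
  classical
  rcases Nat.eq_zero_or_pos m with rfl | hm
  · simp
  unfold vert
  rw [show (fun e : Fin 2 →₀ ℕ => fun i : Fin 2 => ((e i : ℕ) : ℝ)) = emb from rfl]
  set S := emb '' ((zProd m).support : Set (Fin 2 →₀ ℕ)) with hS
  have hfin : (Set.extremePoints ℝ (convexHull ℝ S)).Finite :=
    (((zProd m).support.finite_toSet.image emb).subset extremePoints_convexHull_subset)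
  let P₁ : Finset (Fin 2 → ℝ) := (range (m + 1)).image fun s => emb (expo (Ico s m))
  let P₂ : Finset (Fin 2 → ℝ) := (Ico 1 m).image fun s => emb (expo (range s))
  have hP₁card : P₁.card = m + 1 := by
    rw [Finset.card_image_of_injOn, Finset.card_range]
    intro s hs s' hs' h
    have h0 := congrFun h 0
    simp only [emb, expo_zero, Nat.card_Ico, Nat.cast_inj] at h0
    have hs := Finset.mem_range.mp hs
    have hs' := Finset.mem_range.mp hs'
    omega
  have hP₂card : P₂.card = m - 1 := by
    rw [Finset.card_image_of_injOn, Nat.card_Ico]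
    intro s hs s' hs' h
    have h0 := congrFun h 0
    simpa [emb, expo_zero] using h0
  have hdisj : Disjoint P₁ P₂ := by
    rw [Finset.disjoint_left]
    intro p hp₁ hp₂
    rw [Finset.mem_image] at hp₁ hp₂
    obtain ⟨s, hs, rfl⟩ := hp₁
    obtain ⟨s', hs', h⟩ := hp₂
    have hs := Finset.mem_range.mp hs
    rw [Finset.mem_Ico] at hs'
    have h0 := congrFun h 0
    have h1 := congrFun h 1
    simp only [emb, expo_zero, expo_one, Nat.card_Ico, Finset.card_range, Nat.cast_inj] at h0 h1
    rw [sum_Ico_id, ← h0] at h1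
    have hpos : 0 < s * s' := Nat.mul_pos (by omega) (by omega)
    omega
  have hsub : ((P₁ ∪ P₂ : Finset (Fin 2 → ℝ)) : Set (Fin 2 → ℝ)) ⊆
      Set.extremePoints ℝ (convexHull ℝ S) := by
    intro p hp
    rw [Finset.mem_coe, Finset.mem_union] at hp
    rcases hp with hp | hp
    · rw [Finset.mem_image] at hp
      obtain ⟨s, -, rfl⟩ := hp
      exact emb_expo_Ico_mem_extremePoints m s
    · rw [Finset.mem_image] at hp
      obtain ⟨s, hs, rfl⟩ := hp
      rw [Finset.mem_Ico] at hs
      exact emb_expo_range_mem_extremePoints m s hs.2.le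
  calc 2 * m = (m + 1) + (m - 1) := by omega
    _ = (P₁ ∪ P₂).card := by rw [Finset.card_union_of_disjoint hdisj, hP₁card, hP₂card]
    _ = ((P₁ ∪ P₂ : Finset (Fin 2 → ℝ)) : Set (Fin 2 → ℝ)).ncard := (Set.ncard_coe_finset _).symm
    _ ≤ (Set.extremePoints ℝ (convexHull ℝ S)).ncard := Set.ncard_le_ncard hsub hfin

/-- The weak bound with the `m`-dependence removed (`a = 0`): a bound polynomial in `kt` alone. -/
def NewtonTauBoundNoM : Prop :=
  ∃ b : ℕ, ∀ (k m t : ℕ) (f : Fin k → Fin m → MvPolynomial (Fin 2) ℂ),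
    (∀ i j, (f i j).support.card ≤ t) → vert (∑ i, ∏ j, f i j) ≤ (k * t + 2) ^ b

/-- **`m` is indispensable (the `2^{am}` factor cannot be replaced by `1`)**: with `k = 1`, `t = 2`
the product of the `m` binomials `1 + X Y^j` (a zonogon) has `≥ 2m` vertices, unbounded against
`(1·2+2)^b`.  Equivalently: NewtonTauWeak with `a = 0` is FALSE; KPTT's no-cancellation bound `k·m·t`
is attained at `k = 1`, so any proof must let the bound grow with `m`. -/
theorem not_newtonTauBoundNoM : ¬ NewtonTauBoundNoM := by
  rintro ⟨b, h⟩
  set M := 4 ^ b with hM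
  have hle := h 1 M 2 (fun _ j => zFactor (j : ℕ)) (fun _ j => card_support_zFactor _)
  rw [sum_prod_zFactor] at hle
  have hlow := succ_le_vert_zProd M
  have : (1 * 2 + 2) ^ b = 4 ^ b := by norm_num
  rw [this] at hle
  omega

/-! ## §0' Probe: the crux by name, degenerate corners -/

/-- The crux, by name, is literally the weak KPTT bound on `vert (Σ_i Π_j f i j)`. -/
theorem newtonTauWeak_iff :
    NewtonTauWeak ↔ ∃ a b : ℕ, ∀ (k m t : ℕ) (f : Fin k → Fin m → MvPolynomial (Fin 2) ℂ),
      (∀ i j, (f i j).support.card ≤ t) → vert (∑ i, ∏ j, f i j) ≤ 2 ^ (a * m) * (k * t + 2) ^ b :=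
  Iff.rfl

/-- Degenerate corner `k = 0`: the sum is `0`, no vertices (the bound is never threatened there). -/
theorem vert_sum_fin_zero (m : ℕ) (f : Fin 0 → Fin m → MvPolynomial (Fin 2) ℂ) :
    vert (∑ i, ∏ j, f i j) = 0 := by
  simp [vert]

/-- Degenerate corner `m = 0`: every product is `1`, the sum is the constant `k`, at most one vertex. -/
theorem vert_sum_fin_zero' (k : ℕ) (f : Fin k → Fin 0 → MvPolynomial (Fin 2) ℂ) :
    vert (∑ i, ∏ j, f i j) ≤ 1 := by
  refine (vert_le_card_support _).trans ?_
  have : (∑ i : Fin k, ∏ j : Fin 0, f i j) = monomial 0 (k : ℂ) := by simp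
  rw [this]
  exact (Finset.card_le_card support_monomial_subset).trans (by simp)

/-! ## §A Load-bearing: the sparsity hypothesis -/

/-- The crux with its only hypothesis `∀ i j, #supp (f i j) ≤ t` DELETED (so `t` is free). -/
def NewtonTauWeakWithoutSparsity : Prop :=
  ∃ a b : ℕ, ∀ (k m t : ℕ) (f : Fin k → Fin m → MvPolynomial (Fin 2) ℂ),
    vert (∑ i, ∏ j, f i j) ≤ 2 ^ (a * m) * (k * t + 2) ^ b

/-- A `Fin 1 × Fin 1` sum of products is its single entry (restated for `vert`). -/
theorem sum_prod_fin_one_one (g : MvPolynomial (Fin 2) ℂ) :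
    (∑ _i : Fin 1, ∏ _j : Fin 1, g) = g := by simp

/-- **Load-bearing: any proof must use the sparsity hypothesis.**  Without it take `k = m = 1`, `t = 0`
and the single factor `chainPoly (range (2^a·2^b + 1))` (monomials on a strictly convex lattice chain):
`2^a·2^b + 1` vertices against the bound `2^{a}·2^b`. -/
theorem newtonTauWeak_false_without_sparsity : ¬ NewtonTauWeakWithoutSparsity := by
  rintro ⟨a, b, h⟩
  have hle := h 1 1 0 (fun _ _ => chainPoly (range (2 ^ a * 2 ^ b + 1)))
  rw [sum_prod_fin_one_one] at hle
  change (Set.extremePoints ℝ (convexHull ℝ ((fun e : Fin 2 →₀ ℕ => fun i : Fin 2 => ((e i : ℕ) : ℝ)) ''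
      ((chainPoly (range (2 ^ a * 2 ^ b + 1))).support : Set (Fin 2 →₀ ℕ))))).ncard ≤ _ at hle
  rw [vertices_chainPoly, Finset.card_range] at hle
  have : (1 * 0 + 2) ^ b = 2 ^ b := by norm_num
  rw [this, mul_one] at hle
  omega

/-! ## §B Shape of the bound: `k` and `t` are indispensable too (`m`: `not_newtonTauBoundNoM`) -/

/-- The weak bound with the `k`-dependence removed. -/
def NewtonTauBoundNoK : Prop :=
  ∃ a b : ℕ, ∀ (k m t : ℕ) (f : Fin k → Fin m → MvPolynomial (Fin 2) ℂ),
    (∀ i j, (f i j).support.card ≤ t) → vert (∑ i, ∏ j, f i j) ≤ 2 ^ (a * m) * (t + 2) ^ b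

/-- The weak bound with the `t`-dependence removed. -/
def NewtonTauBoundNoT : Prop :=
  ∃ a b : ℕ, ∀ (k m t : ℕ) (f : Fin k → Fin m → MvPolynomial (Fin 2) ℂ),
    (∀ i j, (f i j).support.card ≤ t) → vert (∑ i, ∏ j, f i j) ≤ 2 ^ (a * m) * (k + 2) ^ b

/-- `k` monomials `X^{n(n-1)/2} Y^n` (one per product, `m = t = 1`) sum to `chainPoly (range k)`. -/
theorem sum_monomial_chainPt (k : ℕ) :
    (∑ i : Fin k, ∏ _j : Fin 1, (monomial (chainPt (i : ℕ)) (1 : ℂ) : MvPolynomial (Fin 2) ℂ)) =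
      chainPoly (range k) := by
  simp only [Finset.prod_const, Finset.card_univ, Fintype.card_fin, pow_one]
  rw [Fin.sum_univ_eq_sum_range (fun n => (monomial (chainPt n) (1 : ℂ) : MvPolynomial (Fin 2) ℂ)) k]
  rfl

/-- **`k` is indispensable**: with `m = t = 1` and `k` monomials on a strictly convex chain (one per
summand) the vertex count is `k`, unbounded against `2^{a}·3^b`. -/
theorem not_newtonTauBoundNoK : ¬ NewtonTauBoundNoK := by
  rintro ⟨a, b, h⟩
  set K := 2 ^ a * 3 ^ b + 1 with hK
  have hle := h K 1 1 (fun i _ => monomial (chainPt (i : ℕ)) 1) (fun i j => by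
    exact (Finset.card_le_card support_monomial_subset).trans (by simp))
  rw [sum_monomial_chainPt] at hle
  change (Set.extremePoints ℝ (convexHull ℝ ((fun e : Fin 2 →₀ ℕ => fun i : Fin 2 => ((e i : ℕ) : ℝ)) ''
      ((chainPoly (range K)).support : Set (Fin 2 →₀ ℕ))))).ncard ≤ _ at hle
  rw [vertices_chainPoly, Finset.card_range] at hle
  have : (1 + 2) ^ b = 3 ^ b := by norm_num
  rw [mul_one, this] at hle
  omega

/-- **`t` is indispensable**: with `k = m = 1` and one `t`-nomial on a strictly convex chain the vertex
count is `t`, unbounded against `2^{a}·3^b`. -/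
theorem not_newtonTauBoundNoT : ¬ NewtonTauBoundNoT := by
  rintro ⟨a, b, h⟩
  set N := 2 ^ a * 3 ^ b + 1 with hN
  have hle := h 1 1 N (fun _ _ => chainPoly (range N)) (fun _ _ => by
    rw [support_chainPoly, Finset.card_image_of_injective _ chainPt_injective, Finset.card_range])
  rw [sum_prod_fin_one_one] at hle
  change (Set.extremePoints ℝ (convexHull ℝ ((fun e : Fin 2 →₀ ℕ => fun i : Fin 2 => ((e i : ℕ) : ℝ)) ''
      ((chainPoly (range N)).support : Set (Fin 2 →₀ ℕ))))).ncard ≤ _ at hle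
  rw [vertices_chainPoly, Finset.card_range] at hle
  have : (1 + 2) ^ b = 3 ^ b := by norm_num
  rw [mul_one, this] at hle
  omega

/-! ## §E Hierarchy (bookkeeping, workfile only): where the crux sits among its neighbours

`NewtonTauPoly` (KPTT Conj. 1 in polynomial form) `→ NewtonTauWeak → TwoProducts` (sibling crux 5906 is the
`k = 2` instance).  So: a refutation of `TwoProducts` refutes this crux; a refutation of this crux refutes
KPTT Conj. 1; nothing flows the other way. -/

section Hierarchy

open Summit.ValiantsHypothesis.ValiantsHypothesis.Theses.NewtonUnitEquations (TwoProducts)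

/-- KPTT's Conjecture 1 in POLYNOMIAL form `p(kmt) = (kmt+2)^C` (stronger than the crux). -/
def NewtonTauPoly : Prop :=
  ∃ C : ℕ, ∀ (k m t : ℕ) (f : Fin k → Fin m → MvPolynomial (Fin 2) ℂ),
    (∀ i j, (f i j).support.card ≤ t) → vert (∑ i, ∏ j, f i j) ≤ (k * m * t + 2) ^ C

/-- `(kmt + 2) ≤ 2^m (kt + 2)`. -/
lemma kmt_le (k m t : ℕ) : k * m * t + 2 ≤ 2 ^ m * (k * t + 2) := by
  have hm : m ≤ 2 ^ m := (Nat.lt_two_pow_self).le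
  have h1 : k * m * t ≤ 2 ^ m * (k * t) := by
    calc k * m * t = m * (k * t) := by ring
      _ ≤ 2 ^ m * (k * t) := Nat.mul_le_mul_right _ hm
  have h2 : 2 ≤ 2 ^ m * 2 := by
    have := Nat.one_le_two_pow (n := m)
    omega
  calc k * m * t + 2 ≤ 2 ^ m * (k * t) + 2 ^ m * 2 := by omega
    _ = 2 ^ m * (k * t + 2) := by ring

/-- The polynomial form implies the crux (with `a = b = C`). -/
theorem newtonTauWeak_of_newtonTauPoly (h : NewtonTauPoly) : NewtonTauWeak := by
  obtain ⟨C, hC⟩ := h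
  refine ⟨C, C, fun k m t f hf => (hC k m t f hf).trans ?_⟩
  calc (k * m * t + 2) ^ C ≤ (2 ^ m * (k * t + 2)) ^ C := Nat.pow_le_pow_left (kmt_le k m t) C
    _ = 2 ^ (C * m) * (k * t + 2) ^ C := by rw [mul_pow, ← pow_mul, mul_comm m C]

/-- The `k = 2` instance: `Π f − Π g` as a sum of two products with the sign absorbed into the first
factor of the second product. -/
lemma prod_sub_prod_eq_sum (m : ℕ) (f g : Fin (m + 1) → MvPolynomial (Fin 2) ℂ) :
    (∏ j, f j - ∏ j, g j) =
      ∑ i : Fin 2, ∏ j : Fin (m + 1),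
        (![f, fun j => if (j : ℕ) = 0 then -g j else g j] : Fin 2 → Fin (m + 1) → MvPolynomial (Fin 2) ℂ) i j := by
  rw [Fin.sum_univ_two]
  simp only [Matrix.cons_val_zero, Matrix.cons_val_one]
  rw [sub_eq_add_neg]
  congr 1
  rw [Fin.prod_univ_succ, Fin.prod_univ_succ]
  simp only [Fin.val_zero, ↓reduceIte, Fin.val_succ, Nat.succ_ne_zero]
  ring

/-- **The crux implies the sibling crux `TwoProducts`** (stmt-5906 is its `k = 2` instance; constants
`a' = a + b`, `b' = b`).  Contrapositive: a kill of `TwoProducts` kills `NewtonTauWeak`. -/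
theorem twoProducts_of_newtonTauWeak (h : NewtonTauWeak) : TwoProducts := by
  obtain ⟨a, b, hab⟩ := h
  refine ⟨a + b, b, fun m t f g hf hg => ?_⟩
  change vert (∏ j, f j - ∏ j, g j) ≤ _
  rcases Nat.eq_zero_or_pos m with hm | hm
  · subst hm
    have : (∏ j : Fin 0, f j - ∏ j : Fin 0, g j) = 0 := by simp
    rw [this]
    simp [vert]
  · obtain ⟨m, rfl⟩ : ∃ m', m = m' + 1 := ⟨m - 1, by omega⟩
    rw [prod_sub_prod_eq_sum]
    set F := (![f, fun j => if (j : ℕ) = 0 then -g j else g j] :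
      Fin 2 → Fin (m + 1) → MvPolynomial (Fin 2) ℂ) with hF
    have hFs : ∀ i j, (F i j).support.card ≤ t := by
      intro i j
      fin_cases i
      · exact hf j
      · change (if ((j : ℕ) = 0) then -g j else g j).support.card ≤ t
        split_ifs
        · rw [support_neg]; exact hg j
        · exact hg j
    refine (hab 2 (m + 1) t F hFs).trans ?_
    have h2 : (2 * t + 2) ^ b ≤ 2 ^ b * (t + 2) ^ b := by
      rw [← mul_pow]
      exact Nat.pow_le_pow_left (by omega) b
    calc 2 ^ (a * (m + 1)) * (2 * t + 2) ^ b ≤ 2 ^ (a * (m + 1)) * (2 ^ b * (t + 2) ^ b) :=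
          Nat.mul_le_mul_left _ h2
      _ = 2 ^ (a * (m + 1) + b) * (t + 2) ^ b := by rw [pow_add]; ring
      _ ≤ 2 ^ ((a + b) * (m + 1)) * (t + 2) ^ b := by
          apply Nat.mul_le_mul_right
          exact Nat.pow_le_pow_right (by norm_num) (by nlinarith)

end Hierarchy

/-! ## §N Why it resists — map of the attack space (notes for provers, ideators, later refuters)

Everything below is prose (docstrings on `True` facts).  Numbers quoted from print carry the page of the
materialised text (`lit read arxiv:1308.2286`, pages p4–p6); kit job ids are given where a computation is
cited.  VERDICT SO FAR (cycle 1): **no kill, and no cheap kill can exist** — the crux is KPTT's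
Conjecture 1 in a form WEAKER than the printed conjecture (so harder to refute), every degenerate corner
is harmless (§0'), and a counterexample family must simultaneously have `vert ≥ 2^{ω(m)}` and
`vert ≥ (kt)^{ω(1)}` (N3).  The two places where a kill could still come from are N1/N2 (a VP Newton
polytope with too many shadow vertices — purely combinatorial, no cancellation design needed) and N4(iii)
(a genuine cancellation design on KPTT's digit grids). -/

/-- **N1. The transfer is generic: the crux bounds the planar shadows of EVERY VP Newton polytope.**
(PRIOR ART, read after first writing this note — Hrubeš–Yehudayoff, "Shadows of Newton polytopes",
CCC 2021, LIPIcs 200:9, lit key paper:url-d136d073b26d: p2 "it can be shown that the τ-conjecture implies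
`σ(DS_n) ≤ 2^{O(√n log² n)}`.  Proving that `σ(DS_n) = 2^{Ω(n)}` refutes this τ-conjecture" (footnote:
observation of Michael Forbes); Prop. 49 p18 (Conj. 47 + circuit of size `s`, degree `d` ⇒
`σ(Newt f) ≤ s^{O(√d log d)}`), Cor. 50 p19 (`σ(DS_n), σ(MATCH_n) ≤ 2^{O(√n log² n)}`; "We do not know
whether these conclusions hold or not"), Prop. 23 p10 (`2^{Ω(log² n)} ≤ σ(DS_n) ≤ 2^{O(n)}`), Open
Problems 1–2 p21 ("Is `σ(DS_n)` or `σ(MATCH_n)` exponential in `n`?"; "Is Conjecture 47 true? If not, is it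
true when `f` is required to have convexly independent support?").  So N1 below is THEIR programme,
re-derived; nothing here is new except the bookkeeping for the weak form.  Their Thm 30 p13/p20 — a
bivariate `p_n` with a MONOTONE circuit of size `O(n)` and `2^n` vertices, `p_{n+1} = p_n(x²,y⁴)² +
x^N y^N q_n(x²,y⁴)²`, `q_{n+1} = p_n(x²,y⁴) q_n(x²,y⁴) + x^{N(N-1)} y^{N²(N-1)}`, `N = 2^{n+1}` — does NOT
bear on the crux: the iterated squaring gives the multilinear lift degree `2^n`, so neither depth
reduction nor any short `ΣΠ`-of-sparse form follows (over `ℂ`, `A² + μB² = (A + √-μ B)(A - √-μ B)` peels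
ONE level into a product, the next level is a binary quadratic form in `(A', B')` plus a monomial and no
longer factors through sparse polynomials).  Chatterjee–Gajjar–Tengse, "Monotone classes beyond VNP",
ECCC TR22-031 rev. 2023, p3 of paper:galaxy-pdf-3611799734385202520: "the τ-conjecture for Newton polygons
is BELIEVED TO BE FALSE" (Newton polygons forget coefficients; det vs per), and p27: refute it by "a
non-monotone circuit upper bound for a transparent polynomial".)
KPTT prove Thm 1 (p4–p5) for the permanent, but the argument uses only: (i) a family `g_n ∈ VP`
(`N` variables, degree `d`, circuit size `s`); (ii) depth reduction to `ΣΠ^{[O(√d)]}ΣΠ^{[√d]}` of size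
`2^{O(√d·log(ds))}` (Koiran/Tavenas, KPTT Thm 2 p5, `t^{O(√d log d)}` resp. `t^{O(√d)}`); (iii) the
substitution `x_i ↦ c_i X^{α_i} Y^{β_i}` (any `α, β ∈ ℕ^N`, generic `c ∈ ℂ^N` so that NO coefficient of the
image cancels: the coefficient of `X^u Y^v` is a nonzero polynomial in `c`), which keeps `t`-sparsity of
the inner polynomials.  Hence, with `vert` the crux's vertex count and
`sh(P) := max_{α,β} #vert(proj_{α,β} P)` the planar SHADOW NUMBER of a polytope:
  `NewtonTauWeak ⇒ sh(Newt g_n) ≤ 2^{O(√d · log(N s))}` for every VP family.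
(The strong form `p(kmt)` gives the SAME threshold, because `k, t` are already `2^{Θ(√d log(Ns))}` after
depth reduction — for this route to a kill, weak and strong KPTT are equally hard to refute.)
KILL TARGET T1: a VP family with `sh(Newt g_n) ≥ 2^{ω(√d log(Ns))}`.  Natural candidates and status:
* Birkhoff polytope `B_n = Newt(det_n)` (`d = n`, `N = n²`): `sh(B_n)` = parametric complexity of the
  ASSIGNMENT problem.  Known: `n^{Ω(log n)}` (Carstensen 1983 / Mulmuley–Shah 2001 Cor. 1.1 via shortest
  paths; planar version Gajjar–Radhakrishnan 2018, held as paper:galaxy-pdf-8855140321140506660 p2–p3) and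
  `sh(B_n) ≤ n·4^n` (rectangle-cover recursion, sibling disprover 5905, note N2 of
  `Cruxes/DissociatedUniform/Disproof.lean`); the crux PREDICTS `sh(B_n) ≤ 2^{O(√n log n)}`.  Nothing in
  print contradicts this; a `2^{Ω(n^{1/2+ε})}` lower bound for parametric assignment would refute the crux
  (and KPTT Conj. 1) outright, with `det ∈ VP` replacing the permanent hypothesis.
* path polytopes (IMM, ABPs): parametric shortest path is `n^{Θ(log n)}` (Gusfield upper bound) — far
  below threshold; spanning trees / matroid bases (`det(A X Aᵀ)`): polynomial (k-set type bounds);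
  planar perfect matchings (FKT Pfaffians ∈ VP), LGV non-intersecting path systems (`det` of path
  matrices ∈ VP): parametric complexity unknown beyond `n^{Ω(log n)}` — same status as `B_n`.
* MONOTONE computation never helps: for cancellation-free circuits `sh(f+g) ≤ sh f + sh g`,
  `sh(fg) ≤ sh f + sh g`, so `sh ≤ #parse-trees ≤ s^{O(log d)}` after VSBR balancing — quasi-polynomial,
  consistent with the crux; Hrubeš–Yehudayoff (CCC 2021, "Shadows of Newton polytopes", NOT HELD:
  acq-01324) use exactly this for monotone lower bounds (transparent polynomials; Jukna, Tropical Circuit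
  Complexity, p50).  So T1 needs a polytope whose vertex set is only VP-enumerable WITH cancellations
  (determinants, Pfaffians) — the parametric-assignment question.
* TRANSPARENT route (HY21/CGT): KPTT's own hard polynomial is a monomial image of the transparent
  `SQ_n = Σ_{S ⊆ [n]} Π_{(i,j) ∈ S×S} x_{ij}`: with `x_{ij} ↦ X^{[i=j]·2^i} Y^{2^{i+j}}` one gets
  `Σ_S X^{w(S)} Y^{w(S)²} = Σ_{N<2^n} X^N Y^{N²}` (`w(S) = Σ_{i∈S} 2^i`).  `SQ_n` at 0/1 points counts
  cliques, so `SQ_n ∉ VP` unless `#P ⊆ FP/poly`; a refutation along this line needs NONZERO complex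
  weights `c_S` making `Σ_S c_S Π_{S×S} x_{ij}` (or any polynomial with a transparent support of size
  `2^{ω(√d log N)}`) VP-computable — "interpolation and other non-monotone tricks" (CGT p27).  Nobody has one. -/
theorem note_transfer_generic : True := trivial

/-- **N2. Elementary block transfer (no depth reduction): short matrix products.**  Let
`M_1,…,M_ℓ` be `w × w` matrices with `t`-sparse bivariate entries, `ℓ = B·m`.  Grouping into `m` blocks
of `B` factors, every entry of `M_1⋯M_ℓ` is `Σ_{s : Fin (m+1) → Fin w} Π_{j<m} N_j(s_j, s_{j+1})`
(with the end-point indicator absorbed into the first factor), i.e. a `Σ^{k}Π^{m}` of `t'`-sparse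
polynomials with `k = w^{m+1}`, `t' ≤ w^{B+1} t^{B}` (a block entry is a sum over `≤ w^{B-1}` paths of
products of `B` `t`-sparse entries).  Hence
  `NewtonTauWeak ⇒ vert((M_1⋯M_ℓ)_{xy}) ≤ 2^{a m} (w^{m+1} · w^{B+1} t^{B} + 2)^b`,
and with `B = m = √ℓ`: `≤ 2^{O(√ℓ · log(w t))}`.
KILL TARGET T2 (formalizable end-to-end, unlike T1): a family of products of `ℓ` matrices of size
`w = O(1)` (even `w = 2`) with `O(1)`-sparse entries — signed monomials `±X^{α}Y^{β}` suffice — whose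
`(x,y)` entry has `2^{ω(√ℓ)}` Newton vertices.  Remarks: (a) WITHOUT cancellation the truth is `poly(ℓ)`
for bounded `w` (parametric shortest path in a width-`w` layered graph: `f(ℓ) ≤ 2w·f(ℓ/2)`), so all of
`poly(ℓ) … 2^{O(√ℓ)}` is unexplained slack of the conjecture in this regime; (b) with exponents bounded by
`E` per factor the support sits in `[0, ℓE]²` and `vert = O((ℓE)^{2/3})` (Andrews–Jarník: lattice points
in convex position), so a T2 family needs exponent scales growing along the product (as KPTT's `X^{2^j}`),
and cancellation needs COINCIDING path exponents: with one exponent scale per step (labels `2^i·D_i`)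
the walk ↦ exponent map is injective as soon as every `D_i` separates "stay" from "switch" (for `w = 2`
a walk from a fixed state is its stay/switch sequence), so coincidences need repeated scales or labels
merging stay/switch, compensated later at a comparable scale;
(c) powers `M^ℓ` of ONE matrix are dead (support = affine image of a triangle of transition counts, signs
constant on fibres ⇒ 3 vertices). -/
theorem note_block_transfer : True := trivial

/-- **N3. What a counterexample must look like (bookkeeping that kills most ideas at once).**
Refuting `∃ a b ∀ …` needs, for every `a, b`, an instance with `vert > 2^{am}(kt+2)^b`; along a family:
`vert ≥ 2^{ω(m)}` AND `vert ≥ (kt)^{ω(1)}`.  Since always `vert ≤ #supp ≤ k·t^m` (`vert_le_card_support`):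
* bounded `m` is hopeless (`vert ≤ k t^m ≤ (kt+2)^m`), bounded `t` is hopeless
  (`vert ≤ k t^m = k·2^{m log t}` never beats `2^{am}` for `a > log t`), `k = 1` is hopeless (Ostrowski:
  `Newt(Π f_j) = Σ Newt f_j`, `vert ≤ m t`, attained: `two_mul_le_vert_zProd`);
* so `m → ∞`, `t → ∞`, and cancellation BETWEEN products must manufacture all but `k·m·t` of the
  vertices (without cancellation `vert ≤ kmt`, KPTT p4): e.g. KPTT Example 3 / Prop. 1 digit grids with
  `t^{m/3}` convexly independent candidates, `t = m`, would need `k = m^{o(m)}` products cancelling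
  everything outside the chain;
* in the transfer picture (N1/N2) the same bookkeeping reads: degree `d` computation with
  `sh ≥ 2^{ω(√d log size)}`.
Every "identity-based" idea dies on this arithmetic: Brion/Barvinok lattice-point identities
(`k = #vertices`, and clearing denominators makes `m ≥ D·#cones`), theta/Jacobi-triple-product and
`q`-binomial truncations (`k = 1`, the parabola `(i, i²)` IS the lower chain of the zonogon
`Π(1 + z q^{2j+1})`, `m+1` of its `2m` vertices), Chebyshev/`M^ℓ` recursions (N2(c)), Ryser-type depth-3
formulas for `per_n` (`k = 2^n ≥ sh(B_n)/n`). -/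
theorem note_counterexample_shape : True := trivial

/-- **N4. Attack ledger (cycle 1) — tried → outcome.**
(i) Degenerate corners `k,m,t ∈ {0,1}`, empty products, constant sums: harmless (§0').
(ii) Drop the hypothesis / a parameter: each genuinely needed (§A, §B, `not_newtonTauBoundNoM`) — in
particular the weak form's `2^{am}` cannot be lowered below `m` (zonogon), and nothing better than
`vert ≤ m t` at `k = 1` can be hoped for in general (KPTT p4: `t`-gons with distinct edge directions).
(iii) Cancellation designs: dissociated frames are the sibling cruxes' territory (5905/5907: every
natural design is `O(m t + t²)` per level set, `Cruxes/DissociatedUniform/Disproof.lean` N3–N5); the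
coincidence regime at `k = 2` is crux 5906 (`fg+1 ≤ O(t^{4/3})`, KPTT Thm 5 p7; conjectured linear).
For the general-`k` coincidence regime (where KPTT's own transfer parameters live, route file
"NOT DECOMPOSED YET") no structure theorem and no design is known; my small searches (N5) probe it.
(iv) Literature kill: none — no printed counterexample to KPTT Conj. 1 or its weak form (searched: KPTT
citers via the route's novelty section; Jukna 2023 book; Gajjar–Radhakrishnan 2018; CGT 2023 read, p3/p27:
"believed to be false", HY21's refutation programme explicitly UNFINISHED; H–Y 2021 itself pending
acq-01324).  `ledger negatives` for this summit: nothing on Newton polygons.  So the expert prior is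
AGAINST the crux, but the only proposed disproof route (N1) is an open problem of its own.
(v) Barrier catalogue (`Literature/Barriers/ValiantsHypothesis/`): TauRealZeros / MonotoneGap /
AlgebraicNaturalProofs / DepthReductionChasm do not bear on the truth of the crux (they concern what the
crux would IMPLY, which is the route's business); no barrier says the conjecture is false. -/
theorem note_attack_ledger : True := trivial

/-- **N5. Experiments (kit jobs; exact integer arithmetic, hill climbing with restarts; vertex counts of
supports).**  E1 `fg − c` for `t`-sparse `f, g` (KPTT §5): j010961.  E2 `AB − CD` (k = m = 2) signed vs
positive-coefficient baseline: j010963 / j010964.  E3 entries of products of `L` signed `2×2`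
(bi)nomial matrices vs positive baseline: j010967 / j010969 (capped by N2(b): exponents ≤ 3 per step).
E4 `Σ_{i<k} Π_{j<m}` of binomials with coinciding small exponents, signed vs positive: j010971 / j010972.
E5 multi-scale signed-monomial `2×2` / `3×3` products (kill target T2): j011490 / j011491 (positive
baseline) / j011496 (`w = 3`).
RESULTS. E1 (j010961, 30 core-min, exponents ≤ 20, coefficients in `±{1,2,3}`): the maximum of
`vert(fg − c)` found is EXACTLY `2t + 1` for every `t ∈ {3,4,5,6,8,10}` (7, 9, 11, 13, 17, 21) — the
trivial "cancel the constant corner, expose two neighbours" gain and nothing more; consistent with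
KPTT's conjectured linear bound for `fg + 1` (their Thm 5 proves `O(t^{4/3})`).  E2 signed (j010963,
25 core-min): max `vert(AB − CD)` = 8, 12, 16, 19, 21 for `t = 2..6`, in every case EQUAL to
`vert(AB) + vert(CD)` of the maximiser (`4t` up to `t = 4`), realised by two products with (almost)
disjoint supports (`2t² − O(1)` monomials): the hill-climber never found a configuration where
cancellation pays — the manufactured-vertex mechanism of KPTT Example 1 exists but does not beat the
no-cancellation count at this size; the positive-coefficient baseline (j010964) reaches the SAME
maxima 8, 12, 16, 19, 21.  E3 (`2×2` products, exponents ≤ 3 per step, the grid-capped regime of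
N2(b)): signed (j010967) 14, 19, 21, 25, 29, 31 versus positive (j010969) 13, 18, 21, 24, 28, 31 for
`L = 4, 6, 8, 10, 12, 14` — linear `≈ 2L + 3`, signs irrelevant.  E4 (`Σ_{i<k}Π_{j<m}` of binomials
`1 ± cX^aY^b`, `a, b ≤ 4`, massive coincidences; j010971 signed): `k = 2`: 12, 16, 19; `k = 3`: 13, 17,
20; `k = 4`: 14, 17, 21; `k = 6`: 15, 18, 21 for `m = 4, 6, 8` — about `2m + k`, far below `kmt = 2km`
and never above the single-zonogon count `2m` by more than `k + O(1)`; the positive baseline (j010972)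
gives 12, 16, 20 / 13, 17, 21 / 14, 17, 21 / 15, 18, 22 — equal or one MORE.  Summary of E1–E4: in
`2 h` of hill climbing over four coincidence-rich families, signed coefficients never produced a single
configuration with more Newton vertices than the best cancellation-free configuration of the same
shape.  E5 (kill target T2; j011490, signed multi-scale `2×2` monomial products, scales `2^σ`/`4^σ`,
two steps per scale, 25 core-min): max vertices of an entry = 14, 18, 22, 26, 29, 35, 37 for
`L = 6, 8, 10, 12, 14, 16, 18` — LINEAR `≈ 2L + 2` although the supports grow to `7·10^4` monomials;
the interim positive baseline (j011491) is 15 at `L = 6`, 31 at `L = 14`, i.e. the same; `w = 3`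
(j011496) 29 at `L = 10`.  Nothing super-linear, let alone `2^{ω(√L)}`. -/
theorem note_experiments : True := trivial

/-- **N7. Counting heuristic for GENERIC cancellation designs (why digit grids do not kill, and what a
killing frame must look like).**  Fix a frame `A_1,…,A_m` (`|A_j| ≤ t`) with potential support
`P = A_1 + ⋯ + A_m` and treat the `k·m·t` coefficients as unknowns.  The coefficient of the SPS at a
point `p ∈ P` is a polynomial in the unknowns; to make a convexly independent chain `C ⊆ P` the vertex
set one must kill every point of `P ∖ conv(C)` (points inside `conv C` are harmless), i.e. impose
`|P ∖ conv(C)|` polynomial equations on `kmt` unknowns.  Generically this needs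
`|P ∖ conv(C)| ≲ k m t`, while a kill needs `|C|` super-polynomial in `kmt`.  So a generic design
needs a frame whose sumset has a super-polynomially long convex chain `C` with only `O(kmt)` sumset
points outside `conv(C)` — a "thin second convex layer".  The first layer (hull vertices of `P` =
Minkowski sum) has `≤ m t` points, so `C` is never the hull itself.  DIGIT GRIDS FAIL: in
`P = {0,…,T-1}²` (`T = t^{m/2}`, KPTT Example 3 / Prop. 1, the `t^{m/3}` candidates), exposing a convex
chain with `V` vertices near a corner means deleting a staircase of `≳ V³` lattice points (a convex
lattice chain with `V` vertices in a `w × h` box needs `wh ≳ V³`, Andrews–Jarník), so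
`V ≲ (kmt)^{1/3}`: polynomial.  Hence on digit grids only NON-generic, identity-like coefficient
structures (more vanishing than degrees of freedom — exactly what theta/`q`-series identities do, N3)
could ever work, and none is known that leaves a long convex chain.  GENERAL FRAMES look no better:
a point of `P` at depth `δ` below a hull edge with normal `n` is `Σ_j a_j` with all but a few `a_j`
`n`-extreme, so the points of bounded "flip number" `r` near an edge form an `r`-bounded subset-sum
set `{Σ_{j∈F} w_j : |F| ≤ r}` whose lower hull has only `poly(m, t, r)` vertices (greedy/`k`-set
structure), while reaching flip number `r` costs a budget of `≈ (mt)^{r}` shallower points.  So the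
plausible answer to the OPEN additive question — is there ANY frame with `|A_j| ≤ t` whose `m`-fold
sumset has a convexly independent `C` with `|C| ≥ (mt)^{ω(1)}` but `|P ∖ conv C| ≤ poly(m,t)`? — is
"no", which would kill the generic-design route entirely and leave only (a) over-determined
identity-type coefficient structures and (b) the VP-shadow route N1/N2.  Worth a clean proof attempt
by a later refuter cycle (it is a statement about sumsets only). -/
theorem note_counting_heuristic : True := trivial

/-- **N6. For provers of the crux (what the negative side suggests).**  (a) The only formal slack you
may use is `2^{am}`: at `k = 1` the truth is `m t` (§C), and N2(a) shows that even `poly(ℓ) → 2^{O(√ℓ)}`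
is slack in the matrix-product regime — a proof strategy that is tight on zonogons and loses `2^{O(m)}`
through cancellation bookkeeping is exactly what the statement permits.  (b) Any proof must be
non-monotone-aware only through SUPPORTS: the statement is insensitive to coefficients except through
which sums vanish (unit equations), so arguments may assume worst-case zero patterns of rank-`k` tensors
on the refined grid (route thesis).  (c) A proof of the crux implies `sh(B_n) ≤ 2^{O(√n log n)}` for the
assignment polytope (N1) — a statement of independent interest in parametric optimisation, currently
open; if that consequence looks false to you, attack T1 instead of proving. -/
theorem note_for_provers : True := trivial

/-! ## §D Block transfer (note N2 made formal): the crux bounds the Newton polygons of entries of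
short matrix products — KILL TARGET T2

`vert_matrixProd_le_of_newtonTauWeak`: under the crux, every entry of a product of `m·B` matrices of
size `w` with `t`-sparse bivariate entries has at most `2^{a m}(w^{m+1}·w^{B+1} t^B + 2)^b` Newton
vertices.  So a family of such products (even `w = 2`, signed monomial entries, `B = m = √ℓ`) with
`2^{ω(√ℓ·log(wt))}` vertices REFUTES the crux; nothing is known beyond `poly(ℓ)` (no cancellation). -/

section MatrixTransfer

open scoped Pointwise

variable {R : Type*} [CommSemiring R] {w : ℕ}

/-- Path-sum expansion of an entry of a product of `m` square matrices: sum over state sequences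
`s : Fin (m+1) → Fin w` pinned at both ends. -/
def pathSum (m : ℕ) (N : Fin m → Matrix (Fin w) (Fin w) R) (x y : Fin w) : R :=
  ∑ s : Fin (m + 1) → Fin w,
    if s 0 = x ∧ s (Fin.last m) = y then ∏ j : Fin m, N j (s j.castSucc) (s j.succ) else 0

/-- `(N₀ ⋯ N_{m-1}) x y = Σ_{s, s₀ = x, s_m = y} Π_j N_j (s_j) (s_{j+1})`. -/
theorem list_prod_ofFn_apply (m : ℕ) (N : Fin m → Matrix (Fin w) (Fin w) R) (x y : Fin w) :
    (List.ofFn N).prod x y = pathSum m N x y := by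
  classical
  induction m generalizing x with
  | zero =>
    rw [List.ofFn_zero, List.prod_nil, Matrix.one_apply, pathSum]
    rw [← (Fin.consEquiv fun _ : Fin 1 => Fin w).sum_comp, Fintype.sum_prod_type]
    simp only [Finset.univ_unique, Finset.sum_singleton, Fin.prod_univ_zero]
    have h0 : ∀ a : Fin w, ((Fin.consEquiv fun _ : Fin 1 => Fin w) (a, default)) 0 = a := fun a => rfl
    have hl : (Fin.last 0) = 0 := rfl
    simp_rw [hl, h0, ite_and]
    rw [Finset.sum_ite_eq' Finset.univ x]
    simp
  | succ m ih =>
    rw [List.ofFn_succ, List.prod_cons, Matrix.mul_apply]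
    simp_rw [ih]
    -- expand the right-hand side along the first state
    rw [pathSum, ← (Fin.consEquiv fun _ : Fin (m + 2) => Fin w).sum_comp, Fintype.sum_prod_type]
    have hcons : ∀ (a : Fin w) (s' : Fin (m + 1) → Fin w),
        (Fin.consEquiv (fun _ : Fin (m + 2) => Fin w)) (a, s') = Fin.cons a s' := fun _ _ => rfl
    simp_rw [hcons]
    have hlast : ∀ (a : Fin w) (s' : Fin (m + 1) → Fin w),
        (Fin.cons a s' : Fin (m + 2) → Fin w) (Fin.last (m + 1)) = s' (Fin.last m) := by
      intro a s'
      rw [← Fin.succ_last, Fin.cons_succ]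
    have hprod : ∀ (a : Fin w) (s' : Fin (m + 1) → Fin w),
        (∏ j : Fin (m + 1), N j ((Fin.cons a s' : Fin (m + 2) → Fin w) j.castSucc)
            ((Fin.cons a s' : Fin (m + 2) → Fin w) j.succ)) =
          N 0 a (s' 0) * ∏ j : Fin m, N j.succ (s' j.castSucc) (s' j.succ) := by
      intro a s'
      have h2 : (∏ j : Fin m, N j.succ ((Fin.cons a s' : Fin (m + 2) → Fin w) j.succ.castSucc)
            ((Fin.cons a s' : Fin (m + 2) → Fin w) j.succ.succ)) =
          ∏ j : Fin m, N j.succ (s' j.castSucc) (s' j.succ) :=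
        Finset.prod_congr rfl fun j _ => by rw [← Fin.succ_castSucc, Fin.cons_succ, Fin.cons_succ]
      rw [Fin.prod_univ_succ, Fin.castSucc_zero, Fin.cons_zero, Fin.cons_succ, h2]
    simp_rw [hlast, hprod]
    have hzero : ∀ (a : Fin w) (s' : Fin (m + 1) → Fin w),
        (Fin.cons a s' : Fin (m + 2) → Fin w) 0 = a := fun a s' => rfl
    simp_rw [hzero]
    -- sum over the first state `a`: only `a = x` survives
    have hsuma : ∀ s' : Fin (m + 1) → Fin w,
        (∑ a : Fin w, if a = x ∧ s' (Fin.last m) = y then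
            N 0 a (s' 0) * ∏ j : Fin m, N j.succ (s' j.castSucc) (s' j.succ) else 0) =
          if s' (Fin.last m) = y then
            N 0 x (s' 0) * ∏ j : Fin m, N j.succ (s' j.castSucc) (s' j.succ) else 0 := by
      intro s'
      simp_rw [ite_and]
      rw [Finset.sum_ite_eq' Finset.univ x]
      simp
    rw [Finset.sum_comm]
    simp_rw [hsuma]
    -- left-hand side: push the factor inside and sum over the first state of `s'`
    simp_rw [pathSum, Finset.mul_sum, mul_ite, mul_zero]
    rw [Finset.sum_comm]
    refine Finset.sum_congr rfl fun s' _ => ?_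
    simp_rw [ite_and]
    rw [Finset.sum_ite_eq Finset.univ (s' 0)]
    simp

/-- Sparsity bookkeeping: the support of a product has at most the product of the support sizes. -/
theorem card_support_prod_le {ι : Type*} (s : Finset ι) (g : ι → MvPolynomial (Fin 2) ℂ) :
    (∏ i ∈ s, g i).support.card ≤ ∏ i ∈ s, (g i).support.card := by
  classical
  induction s using Finset.induction_on with
  | empty =>
    simp only [Finset.prod_empty]
    exact (Finset.card_le_card support_one.subset).trans (by simp)
  | insert a s ha ih =>
    rw [Finset.prod_insert ha, Finset.prod_insert ha]
    calc ((g a) * ∏ i ∈ s, g i).support.card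
        ≤ ((g a).support + (∏ i ∈ s, g i).support).card := Finset.card_le_card (support_mul _ _)
      _ ≤ (g a).support.card * (∏ i ∈ s, g i).support.card := Finset.card_add_le
      _ ≤ (g a).support.card * ∏ i ∈ s, (g i).support.card := Nat.mul_le_mul_left _ ih

/-- Sparsity bookkeeping: the support of a sum has at most the sum of the support sizes. -/
theorem card_support_sum_le {ι : Type*} (s : Finset ι) (g : ι → MvPolynomial (Fin 2) ℂ) :
    (∑ i ∈ s, g i).support.card ≤ ∑ i ∈ s, (g i).support.card := by
  classical
  exact (Finset.card_le_card support_sum).trans Finset.card_biUnion_le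

/-- A path sum of `B` matrices with `t`-sparse entries is `w^{B+1} t^B`-sparse. -/
theorem card_support_pathSum_le (B t : ℕ) (N : Fin B → Matrix (Fin w) (Fin w) (MvPolynomial (Fin 2) ℂ))
    (hN : ∀ j u v, (N j u v).support.card ≤ t) (x y : Fin w) :
    (pathSum B N x y).support.card ≤ w ^ (B + 1) * t ^ B := by
  classical
  unfold pathSum
  refine (card_support_sum_le _ _).trans ?_
  have hterm : ∀ s : Fin (B + 1) → Fin w,
      (if s 0 = x ∧ s (Fin.last B) = y then ∏ j : Fin B, N j (s j.castSucc) (s j.succ) else 0).support.card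
        ≤ t ^ B := by
    intro s
    split_ifs
    · refine (card_support_prod_le _ _).trans ?_
      calc ∏ j : Fin B, (N j (s j.castSucc) (s j.succ)).support.card ≤ ∏ _j : Fin B, t :=
            Finset.prod_le_prod' fun j _ => hN j _ _
        _ = t ^ B := by simp
    · simp
  calc ∑ s : Fin (B + 1) → Fin w,
        (if s 0 = x ∧ s (Fin.last B) = y then ∏ j : Fin B, N j (s j.castSucc) (s j.succ) else 0).support.card
      ≤ ∑ _s : Fin (B + 1) → Fin w, t ^ B := Finset.sum_le_sum fun s _ => hterm s
    _ = w ^ (B + 1) * t ^ B := by simp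

/-- The `i`-th block of `B` consecutive factors of a family indexed by `Fin (m·B)`. -/
def blockFn {X : Type*} (m B : ℕ) (M : Fin (m * B) → X) (i : Fin m) : Fin B → X := fun j =>
  M ⟨i * B + j, by
    calc (i : ℕ) * B + j < i * B + B := by have := j.isLt; omega
      _ = (i + 1) * B := by ring
      _ ≤ m * B := Nat.mul_le_mul_right _ (by have := i.isLt; omega)⟩

/-- Blocks: the product of `m·B` matrices is the product of the `m` block products. -/
theorem list_prod_ofFn_blocks (m B : ℕ) (M : Fin (m * B) → Matrix (Fin w) (Fin w) R) :
    (List.ofFn M).prod = (List.ofFn fun i : Fin m => (List.ofFn (blockFn m B M i)).prod).prod := by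
  rw [List.ofFn_mul, List.prod_flatten, List.map_ofFn]
  rfl

/-- **N2 made formal.**  Under the crux, an entry of a product of `ℓ = m·B` matrices of size `w` with
`t`-sparse bivariate entries has at most `2^{a m} (w^{m+1} · (w^{B+1} t^B) + 2)^b` Newton-polygon
vertices (it is a sum of `w^{m+1}` products of `m` block entries, each `w^{B+1}t^B`-sparse).  With
`B = m = √ℓ` this is `2^{O(√ℓ · log(w t))}`: a family of products of `2 × 2` signed-monomial matrices whose
entries have `2^{ω(√ℓ)}` vertices would refute `NewtonTauWeak` (kill target T2 of note N2). -/
theorem vert_matrixProd_le_of_newtonTauWeak (h : NewtonTauWeak) :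
    ∃ a b : ℕ, ∀ (w m B t : ℕ) (M : Fin (m * B) → Matrix (Fin w) (Fin w) (MvPolynomial (Fin 2) ℂ)),
      (∀ i u v, (M i u v).support.card ≤ t) → ∀ x y : Fin w,
        vert ((List.ofFn M).prod x y) ≤ 2 ^ (a * m) * (w ^ (m + 1) * (w ^ (B + 1) * t ^ B) + 2) ^ b := by
  classical
  obtain ⟨a, b, hab⟩ := h
  refine ⟨a, b, fun w m B t M hM x y => ?_⟩
  -- block products and their sparsity
  let N : Fin m → Matrix (Fin w) (Fin w) (MvPolynomial (Fin 2) ℂ) := fun i =>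
    (List.ofFn (blockFn m B M i)).prod
  have hNdef : ∀ i, N i = (List.ofFn (blockFn m B M i)).prod := fun i => rfl
  have hNsparse : ∀ i u v, (N i u v).support.card ≤ w ^ (B + 1) * t ^ B := by
    intro i u v
    rw [hNdef, list_prod_ofFn_apply]
    exact card_support_pathSum_le B t _ (fun j u v => hM _ u v) u v
  have hprod : (List.ofFn M).prod x y = pathSum m N x y := by
    rw [list_prod_ofFn_blocks m B M, list_prod_ofFn_apply]
  -- the case `m = 0`: the product is `1`, at most one vertex
  rcases Nat.eq_zero_or_pos m with hm | hm
  · subst hm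
    have h1 : vert ((List.ofFn M).prod x y) ≤ 1 := by
      refine (vert_le_card_support _).trans ?_
      have : (List.ofFn M).prod x y = (1 : Matrix (Fin w) (Fin w) (MvPolynomial (Fin 2) ℂ)) x y := by
        rw [hprod, ← list_prod_ofFn_apply, List.ofFn_zero, List.prod_nil]
      rw [this, Matrix.one_apply]
      split_ifs
      · exact (Finset.card_le_card support_one.subset).trans (by simp)
      · simp
    calc vert ((List.ofFn M).prod x y) ≤ 1 := h1
      _ ≤ 2 ^ (a * 0) * (w ^ (0 + 1) * (w ^ (B + 1) * t ^ B) + 2) ^ b := by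
          rw [Nat.mul_zero, pow_zero, one_mul]
          exact Nat.one_le_pow _ _ (by omega)
  -- `m ≥ 1`: present the path sum in the crux's `Σ_{i<k} Π_{j<m}` shape, `k = w^{m+1}`
  haveI : NeZero m := ⟨by omega⟩
  let e : Fin (w ^ (m + 1)) ≃ (Fin (m + 1) → Fin w) := finFunctionFinEquiv.symm
  let F : (Fin (m + 1) → Fin w) → Fin m → MvPolynomial (Fin 2) ℂ := fun s j =>
    if (j : ℕ) = 0 ∧ ¬ (s 0 = x ∧ s (Fin.last m) = y) then 0 else N j (s j.castSucc) (s j.succ)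
  have hF : ∀ s, (∏ j : Fin m, F s j) =
      if s 0 = x ∧ s (Fin.last m) = y then ∏ j : Fin m, N j (s j.castSucc) (s j.succ) else 0 := by
    intro s
    by_cases hc : s 0 = x ∧ s (Fin.last m) = y
    · rw [if_pos hc]
      refine Finset.prod_congr rfl fun j _ => ?_
      simp [F, hc]
    · rw [if_neg hc]
      apply Finset.prod_eq_zero (Finset.mem_univ (0 : Fin m))
      simp [F, hc]
  have hFsparse : ∀ s j, (F s j).support.card ≤ w ^ (B + 1) * t ^ B := by
    intro s j
    simp only [F]
    split_ifs
    · simp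
    · exact hNsparse _ _ _
  have hshape : (∑ i : Fin (w ^ (m + 1)), ∏ j : Fin m, F (e i) j) = pathSum m N x y := by
    rw [e.sum_comp (fun s => ∏ j : Fin m, F s j)]
    simp_rw [hF]
    rfl
  have := hab (w ^ (m + 1)) m (w ^ (B + 1) * t ^ B) (fun i j => F (e i) j) (fun i j => hFsparse _ _)
  change vert (∑ i : Fin (w ^ (m + 1)), ∏ j : Fin m, F (e i) j) ≤ _ at this
  rw [hshape, ← hprod] at this
  exact this

/-- **Kill target T2 in its simplest dress.**  Under the crux there is a constant `c` such that every entry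
of a product of `m²` signed-MONOMIAL `2 × 2` matrices (entries with at most one monomial) has at most
`2^{c(m+1)}` Newton-polygon vertices — i.e. `2^{O(√ℓ)}` for length `ℓ`.  A family beating every such
`c` refutes `NewtonTauWeak`. -/
theorem vert_twoByTwo_monomialProd_le_of_newtonTauWeak (h : NewtonTauWeak) :
    ∃ c : ℕ, ∀ (m : ℕ) (M : Fin (m * m) → Matrix (Fin 2) (Fin 2) (MvPolynomial (Fin 2) ℂ)),
      (∀ i u v, (M i u v).support.card ≤ 1) → ∀ x y : Fin 2,
        vert ((List.ofFn M).prod x y) ≤ 2 ^ (c * (m + 1)) := by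
  obtain ⟨a, b, hab⟩ := vert_matrixProd_le_of_newtonTauWeak h
  refine ⟨a + 3 * b, fun m M hM x y => (hab 2 m m 1 M hM x y).trans ?_⟩
  have h1 : 2 ^ (m + 1) * (2 ^ (m + 1) * 1 ^ m) + 2 ≤ 2 ^ (2 * m + 3) := by
    rw [one_pow, mul_one, ← pow_add]
    have : 2 ≤ 2 ^ (m + 1 + (m + 1)) := by
      calc (2 : ℕ) = 2 ^ 1 := by norm_num
        _ ≤ 2 ^ (m + 1 + (m + 1)) := Nat.pow_le_pow_right (by norm_num) (by omega)
    calc 2 ^ (m + 1 + (m + 1)) + 2 ≤ 2 ^ (m + 1 + (m + 1)) + 2 ^ (m + 1 + (m + 1)) := by omega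
      _ = 2 ^ (2 * m + 3) := by rw [← two_mul, ← pow_succ']; ring_nf
  calc 2 ^ (a * m) * (2 ^ (m + 1) * (2 ^ (m + 1) * 1 ^ m) + 2) ^ b
      ≤ 2 ^ (a * m) * (2 ^ (2 * m + 3)) ^ b :=
        Nat.mul_le_mul_left _ (Nat.pow_le_pow_left h1 b)
    _ = 2 ^ (a * m + b * (2 * m + 3)) := by rw [← pow_mul, ← pow_add]; ring_nf
    _ ≤ 2 ^ ((a + 3 * b) * (m + 1)) := Nat.pow_le_pow_right (by norm_num) (by nlinarith)

end MatrixTransfer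

end

end Summit.ValiantsHypothesis.ValiantsHypothesis.Cruxes.NewtonTauWeak.Disproof
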